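import Literature.MathematicalPhysics.QuantumFieldTheory.Balaban1983to89.B16NodeKnitRecord13
import Literature.MathematicalPhysics.QuantumFieldTheory.Balaban1983to89.Node00.Record13CoPH

/-!
# `Balaban1983to89.B16NodeKnitRecord13CoPH` — YM-DAG node N13 · [Balaban1989LargeFieldII] CMP **122** (1989) 355–392, Theorem 1 p. 355 + (0.1), Cor. 3 pp. 387 ∕ 391
# AT NODE 00's STAGE-13 OBJECTS OF RECORD AT PRINT's BACKGROUND `UbgOfRecord₁₃CoPH` (director-ym LINE №152 RULING (β): [6]'s minimiser over the class (1.7) ∧ (1.9) =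
# node00-def-R's `UbgMSCoOfRecord` p512668; node00-def-T FILE 27 `Node00/Record13CoPH.lean` p537939 (v1.7, director-ym №183 H1ʰ ∕ №186 (α) ∕ №190), rule T₇ `KEYMAP-Record13-v1.7.md`) UNDER THE BACKGROUND-FREE CORE PROVISOS `Stage13HParams.Provisos₁₃CoPH`
# — THE Co TWIN OF THIS SEAT's EDITION-FREE JUNCTION `B16NodeKnitRecord13Core` (p511513) AND OF MODULE 36's h-FREE PIN READING AND TWO RECORD-KEYED FORMS, STATED ONCE FOR EVERY
# PROVISO EDITION OVER THAT BACKGROUND (v1.7 `Provisos₁₃SepCoPH` and successors, at `h.toCore`)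

statement-level bookkeeping over published theorems with citation tags; kernel-checked compositions of tree theorems;
nothing here is a claim about the Yang–Mills mass gap.

CITATION HEADER (lean-in-tree rule).  Source: T. Bałaban, *Large field renormalization. II. Localization, exponentiation, and bounds for the 𝐑 operation*, Commun. Math.
Phys. **122**, 355–392 (1989) [Balaban1989LargeFieldII], with [Balaban1988Convergent] (CMP 119: Thm 1 p. 262, Theorem p. 245, p. 244, (2.18) p. 257, Cor. 3 (2.50) p. 264).
Typed by the CONSUMER seat `pub-ymgap-dag-n24-c` (gen 6; trigger = director-ym №190 PRESS WORD + def-T FILE 27 ACCEPTED; = the v1.6 `B16NodeKnitRecord13CoPH` p532159 under T₇).  A NEW importing module (imports module 36 `B16NodeKnitRecord13` —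
whence module 13's construction-generic engine `B16NodeKnitRepTowerOfRecord.b16_main_at_repTowerOfRecord_along`, seat dag-n11-a's `B14NodeKnitRecord9.b14_main_at_construction_rhoOfRecord9_along`,
module 17's Cor.-3 END theorem `B16NodeKnitRecord9Cor3.uvIneq_at_construction_of_gas` — and def-T's `Node00.Record13CoPH`).  THEOREMS ONLY, def-free, sorry-free, standard axioms.
= `B16NodeKnitRecord13Core` §1–§5 + `B16NodeKnitRecord13` §0 ∕ §3's record-keyed pair under KEY-RULE-21: the key `(h : θ.Provisos₁₃CoPH F N)` UNCHANGED; `datumOfRecord₁₃Core ↦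
datumOfRecord₁₃CoPH`, `IsRecordOfRecord₁₃C ↦ IsRecordOfRecord₁₃CCoPH`; inside statements `SLaw₁₃ ↦ SLaw₁₃CoPH`, `TLaw₁₃ ↦ TLaw₁₃CoPH`, `θ.toStage5₁₃ ↦ θ.toStage5₁₃CoPH`, `coreOfRecord₁₃ ↦
coreOfRecord₁₃CoPH`, `sLaw₁₃_zero ↦ sLaw₁₃CoPH_zero`, `datumOfRecord₁₃_C ↦ datumOfRecord₁₃CoPH_C`, `rOperation_upOfRecord₅C_stage13_iff ↦ …stage13CoPH_iff` (R2 ∕ R3); background-FREE and unchanged: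
`densOfRecord₁₃` (= `rhoOfRecord9 …`), `gOfRecord₁₃`, `betaOfRecord₁₃`, `EOfRecord₁₃`, `chiβOfRecord₁₃`, `wilsonBGOfRecord`, K0e's `chiFix29OfRecord_mem_Icc`; own stems `…₁₃Core ↦ …₁₃CoPH`,
`_core ↦ _coPH`; every proof term is the Core edition's (module 13's engine at `M := coreOfRecord₁₃CoPH F N θ`, `Laws k _ := SLaw₁₃CoPH … k`, `LawsT k _ := TLaw₁₃CoPH … k`, `hS9 := Iff.rfl` by
def-T's `sect2Form_coreOfRecord₁₃CoPH_iff`).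

WHY CORE-KEYED SUFFICES.  N13's products are displayed hypotheses at the θ-LEVEL objects `SLaw₁₃CoPH ∕ TLaw₁₃CoPH ∕ densOfRecord₁₃ ∕ gOfRecord₁₃ ∕ betaOfRecord₁₃ ∕ chiβOfRecord₁₃`; the
provisos enter ONLY through the datum `datumOfRecord₁₃CoPH θ h` (its `.C` in the world-binding equation), which def-T keys on the background-free `Provisos₁₃CoPH` and bridges to
every edition by `rfl` (`datumOfRecord₁₃SepCoPH F N θ h = datumOfRecord₁₃CoPH F N θ h.toCore`).

WHAT THIS FILE PROVES (12 theorems).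
§0 `rOperation_iff_laws₁₃CoPH` — h-free: at a run bound by the C-binding over `θ.toStage5₁₃CoPH`, `(leavesP w P).rOperation ↔ ∀ k < K, TLaw₁₃CoPH θ P k → SLaw₁₃CoPH θ P (k+1)`.
§1 `uvBounds_iff_densOfRecord₁₃_coPH` (N13's conclusion at a Co Stage-13 world IS (0.1) pointwise on `densOfRecord₁₃`), **`b16_main_at_record₁₃CoPH`** (N13 from (R₁₃) `hR13` + (UV₁₃) `hUV13`
   below `γ₁ ≥ w.γ`), `uvIneq_densOfRecord₁₃_of_b16_main_coPH` (A4 locator: what N13 says).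
§2 **`nodes_N11_N13_at_record₁₃CoPH`** (N11 ∧ N13 from the slot triple (S1ᵀ) `hT` ∕ (R₁₃) ∕ (UV₁₃); N11 = dag-n11-a's generic knit with the start `sLaw₁₃CoPH_zero`), `uvStability4D_at_record₁₃CoPH`.
§3 `b16_main_at_record₁₃CoPH_dominated` (N13 from (R₁₃) + the Cor.-3 chain's DOMINATED constants, `0 ≤ χ` by K0e).
§4 `uvIneq_at_record₁₃CoPH_iff`, `uvIneq_at_record₁₃CoPH_of_gas` (the chain's END theorem at the Co objects of record).
§5 `b16_main_at_record₁₃CoPH_of_chainLetters` (N13 from (R₁₃) + the chain's output in its own letters).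
§6 RECORD-KEYED: **`b16_main_of_isRecordOfRecord₁₃CCoPH`**, **`nodes_N11_N13_of_isRecordOfRecord₁₃CCoPH`** (N13, resp. N11 ∧ N13, at every run of a Co record from the per-presentation
   slots — the forms N24's `N24KnitStage13AllCoPH` §1 consumes).

HONEST FRAMING.  Count-neutral SLOT bookkeeping: N13 ∕ N11 NOT discharged — their products are the displayed hypotheses; [Balaban1989LargeFieldII] Thm 1's 𝐑-construction and
[Balaban1988Convergent] Cor. 3 are NOT asserted; NOT vacuous MODULO the K0-class inhabitation item of the edition (NOT claimed).  One finite four-torus programme at fixed `ε`;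
nothing continuum ∕ ℝ⁴ ∕ OS ∕ mass gap ∕ Clay.
-/

noncomputable section

open MeasureTheory
open scoped BigOperators

namespace Literature.MathematicalPhysics.QuantumFieldTheory.Balaban1983to89.B16NodeKnitRecord13CoPH

open DagBinding T4DatumAssembly T4Continuum Node00 FlowStepRuns
open B16NodeKnitRepTowerOfRecord (uvBounds_iff_construction b16_main_at_repTowerOfRecord_along)
open B14NodeKnitRecord9 (b14_main_at_construction_rhoOfRecord9_along)
open B16NodeKnitRecord9Cor3 (uvIneq_at_construction_iff uvIneq_at_construction_of_gas)
open B14Thm2 (Ineq249)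
open B16Cor3Ops (Repr172)
open TreeLengthTorus (tsys)
open B13FamilySum (Ineq126 VolBound)
open B16Eq190Resummation (bracket mayerTerm F191 polys190 LocalOps DepOn)

variable (F : T4Family) (N : ℕ) [NeZero N]

/-! ## §0. The 𝐑-leaf at Stage 13, print's background (director-ym №152 (β)): law transport along the Co tower of record (h-free) -/

/-- **THE 𝐑-LEAF AT STAGE 13 (PRINT's BACKGROUND `UbgOfRecord₁₃CoPH`) IS LAW TRANSPORT ALONG THE Co TOWER OF RECORD** (node00-def-T's `rOperation_upOfRecord₅C_stage13CoPH_iff` behind the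
binding equation; the Co twin of module 36's `rOperation_iff_laws₁₃`): at a run bound by the C-binding of record over the Co Stage-13 view,
`(leavesP w P).rOperation ↔ ∀ k < P.K, TLaw₁₃CoPH F N θ P k → SLaw₁₃CoPH F N θ P (k+1)`. [cite: Balaban1988Convergent, p.244 and Thm 2 p.263; Balaban1989LargeFieldII, Thm 1 p.355 (bookkeeping: the leaf unfolded)] -/
theorem rOperation_iff_laws₁₃CoPH (θ : Stage13HParams F N) (w : WorldP) (P : B12.RunParams) (hup : w.up P = upOfRecord₅C F N (θ.toStage5₁₃CoPH F N) P) :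
    (leavesP w P).rOperation ↔ ∀ k, k < P.K → TLaw₁₃CoPH F N θ P k → SLaw₁₃CoPH F N θ P (k + 1) := by
  show (w.up P).rOperation ↔ _
  rw [hup]
  exact rOperation_upOfRecord₅C_stage13CoPH_iff F N θ P

/-! ## §1. N13 at `Stage13Params` under `Provisos₁₃CoPH`, Co datum `datumOfRecord₁₃CoPH`, Co laws `SLaw₁₃CoPH ∕ TLaw₁₃CoPH` (module 36 §1 at print's background) -/

section AtParams

variable (θ : Stage13HParams F N) (w : WorldP) (P : B12.RunParams) (h : θ.Provisos₁₃CoPH F N)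

/-- **N13's CONCLUSION AT A STAGE-13 WORLD IS (0.1) POINTWISE ON THE DENSITIES OF RECORD**: for `w.C = (datumOfRecord₁₃CoPH F N θ h).C`, `(leavesP w P).uvBounds` IS «for
every `k ≤ K` and every gauge field `U` on `T^{(k)}`: `χ_k(U)·exp[−A^η_k(U)∕g_k² − e₋(g_k)·|T₁^{(k)}|] ≤ ρ_k(U) ≤ exp[e₊(g_k)·|T₁^{(k)}|]`» with `χ_k = chiβOfRecord₁₃ F N θ.toStage13Params P.K
(gOfRecord₁₃ θ P) k` (the (2.9) species `chiFixed29 θ.ν θ.ε₂₉`), `A^η_k = wilsonBGOfRecord F N θ.εbg P k`, `g_k = gOfRecord₁₃ F N θ.toStage13Params P k`, `ρ_k = densOfRecord₁₃ F N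
θ P k` (= `rhoOfRecord9 …` = `eval rep_k`, EXPLICIT) and the world's dependence functions `e₋ = w.em`, `e₊ = w.ep` (`rfl` through `datumOfRecord₁₃CoPH_C` and module
13's `uvBounds_iff_construction`). [cite: Balaban1989LargeFieldII, (0.1) pp.355–356; Balaban1988Convergent, (2.18) p.257, Cor. 3 (2.50) p.264] -/
theorem uvBounds_iff_densOfRecord₁₃_coPH (hC : w.C = (datumOfRecord₁₃CoPH F N θ h).C) :
    (leavesP w P).uvBounds ↔
      ∀ k, k ≤ P.K → ∀ U : GaugeField (F.P P.K) k (SU N),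
        chiβOfRecord₁₃ F N θ.toStage13Params P.K (gOfRecord₁₃ F N θ.toStage13Params P) k U *
              Real.exp (-(1 / (gOfRecord₁₃ F N θ.toStage13Params P k) ^ 2 * wilsonBGOfRecord F N θ.εbg P k U)
                - w.em (gOfRecord₁₃ F N θ.toStage13Params P k) * (Fintype.card (Site (F.P P.K) k) : ℝ)) ≤ densOfRecord₁₃ F N θ.toStage13Params P k U ∧
        densOfRecord₁₃ F N θ.toStage13Params P k U ≤ Real.exp (w.ep (gOfRecord₁₃ F N θ.toStage13Params P k) * (Fintype.card (Site (F.P P.K) k) : ℝ)) :=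
  uvBounds_iff_construction F N (coreOfRecord₁₃CoPH F N θ) (densOfRecord₁₃ F N θ.toStage13Params) w P (hC.trans (datumOfRecord₁₃CoPH_C F N θ h))

/-- **N13 AT A STAGE-13 WORLD** ([Balaban1989LargeFieldII] Thm 1 p. 355 + (0.1), Cor. 3 pp. 387 ∕ 391, AT NODE 00's REPRESENTED TOWER OF RECORD, repaired laws): for `w.C =
(datumOfRecord₁₃CoPH F N θ h).C` and `w.up P = upOfRecord₅C F N (θ.toStage5₁₃CoPH F N) P`, `Dag.B16_main (leavesP w P)` from N13's two OWN products at the objects of record — **(R₁₃)**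
`hR13 : ∀ k < P.K, TLaw₁₃CoPH F N θ P k → SLaw₁₃CoPH F N θ P (k+1)` (𝐑 transports the corresponding space of `𝐓ρ_k` into the repaired §2 format of `ρ_{k+1}`; IS the leaf
`ROpLeaf (VOfRecord₁₃CoPH θ P)` — `rOperation_iff_laws₁₃CoPH` — NO pin hypothesis) and **(UV₁₃)** `hUV13` ((0.1) pointwise on `densOfRecord₁₃ θ P k`
for repaired-§2-format levels `SLaw₁₃CoPH … k`, below `γ₁ ≥ w.γ`; p. 387).  Module 13's `b16_main_at_repTowerOfRecord_along` at `M := coreOfRecord₁₃CoPH F N θ`, `Laws k _ := SLaw₁₃CoPH … k`,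
`LawsT k _ := TLaw₁₃CoPH … k`, `hS9 := Iff.rfl` (`sect2Form_coreOfRecord₁₃CoPH_iff`).  HYPOTHESES displayed; count-neutral.
[cite: Balaban1989LargeFieldII, Thm 1 p.355, (0.1) pp.355–356, p.387, p.391; Balaban1988Convergent, p.244, (2.18) p.257, Cor. 3 p.264] -/
theorem b16_main_at_record₁₃CoPH (hC : w.C = (datumOfRecord₁₃CoPH F N θ h).C) (hup : w.up P = upOfRecord₅C F N (θ.toStage5₁₃CoPH F N) P)
    (hR13 : ∀ k, k < P.K → TLaw₁₃CoPH F N θ P k → SLaw₁₃CoPH F N θ P (k + 1)) {γ₁ : ℝ} (hγ : w.γ ≤ γ₁)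
    (hUV13 : (genFlow (betaOfRecord₁₃ F N θ.toStage13Params) P.g0).InInterval γ₁ P.K → ∀ k, k ≤ P.K → SLaw₁₃CoPH F N θ P k →
      ∀ U : GaugeField (F.P P.K) k (SU N),
        chiβOfRecord₁₃ F N θ.toStage13Params P.K (gOfRecord₁₃ F N θ.toStage13Params P) k U *
              Real.exp (-(1 / (gOfRecord₁₃ F N θ.toStage13Params P k) ^ 2 * wilsonBGOfRecord F N θ.εbg P k U)
                - w.em (gOfRecord₁₃ F N θ.toStage13Params P k) * (Fintype.card (Site (F.P P.K) k) : ℝ)) ≤ densOfRecord₁₃ F N θ.toStage13Params P k U ∧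
        densOfRecord₁₃ F N θ.toStage13Params P k U ≤ Real.exp (w.ep (gOfRecord₁₃ F N θ.toStage13Params P k) * (Fintype.card (Site (F.P P.K) k) : ℝ))) :
    Dag.B16_main (leavesP w P) :=
  b16_main_at_repTowerOfRecord_along F N (coreOfRecord₁₃CoPH F N θ) w P θ.ν θ.τ9 (EOfRecord₁₃ F N θ.toStage13Params) (wOfRecord₉ F N θ.toStage9Params) θ.ppSel
    (gOfRecord₁₃ F N θ.toStage13Params) (fun k _ => SLaw₁₃CoPH F N θ P k) (fun k _ => TLaw₁₃CoPH F N θ P k) (hC.trans (datumOfRecord₁₃CoPH_C F N θ h))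
    (fun _ _ => Iff.rfl) (rOperation_iff_laws₁₃CoPH F N θ w P hup).2 hR13 hγ hUV13

/-- **What N13's Cor.-3 product SAYS at Stage 13** (A4 locator): N13 at a ₁₃ world with its in-edge leaves, the interval hypothesis on `]0, w.γ]` for the generated flow
and repaired-§2-format levels `∀ k ≤ K, SLaw₁₃CoPH F N θ P k` YIELDS (0.1) POINTWISE ON `densOfRecord₁₃ F N θ.toStage13Params P k`, every `k ≤ K`, every configuration.
[cite: Balaban1989LargeFieldII, (0.1) pp.355–356 (bookkeeping); Balaban1988Convergent, (2.18) p.257] -/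
theorem uvIneq_densOfRecord₁₃_of_b16_main_coPH (hC : w.C = (datumOfRecord₁₃CoPH F N θ h).C) (hN : Dag.B16_main (leavesP w P))
    (h5 : (leavesP w P).b5) (h6 : (leavesP w P).b6) (h7 : (leavesP w P).b7) (h9 : (leavesP w P).b9) (h10 : (leavesP w P).b10)
    (h11 : (leavesP w P).b11) (h13 : (leavesP w P).b13) (hrb : (leavesP w P).rBasicStep)
    (hsf : (leavesP w P).smallCouplings → (leavesP w P).smallFieldInductive)
    (hsc : (genFlow (betaOfRecord₁₃ F N θ.toStage13Params) P.g0).InInterval w.γ P.K) (hlaws : ∀ k, k ≤ P.K → SLaw₁₃CoPH F N θ P k)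
    (k : ℕ) (hk : k ≤ P.K) (U : GaugeField (F.P P.K) k (SU N)) :
    chiβOfRecord₁₃ F N θ.toStage13Params P.K (gOfRecord₁₃ F N θ.toStage13Params P) k U *
          Real.exp (-(1 / (gOfRecord₁₃ F N θ.toStage13Params P k) ^ 2 * wilsonBGOfRecord F N θ.εbg P k U)
            - w.em (gOfRecord₁₃ F N θ.toStage13Params P k) * (Fintype.card (Site (F.P P.K) k) : ℝ)) ≤ densOfRecord₁₃ F N θ.toStage13Params P k U ∧
      densOfRecord₁₃ F N θ.toStage13Params P k U ≤ Real.exp (w.ep (gOfRecord₁₃ F N θ.toStage13Params P k) * (Fintype.card (Site (F.P P.K) k) : ℝ)) := by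
  have hC' : w.C = (coreOfRecord₁₃CoPH F N θ).construction (densOfRecord₁₃ F N θ.toStage13Params) := hC.trans (datumOfRecord₁₃CoPH_C F N θ h)
  have hdd : (leavesP w P).smallCouplings → (leavesP w P).densitiesDescribed := by
    intro _
    change ∀ k, k ≤ P.K → (w.C P).Sect2Form k
    rw [hC']
    exact hlaws
  have hsc' : (leavesP w P).smallCouplings := by
    change (w.C P).flow.InInterval w.γ P.K
    rw [hC']
    exact hsc
  have huv : (leavesP w P).uvBounds := (hN h5 h6 h7 h9 h10 h11 h13 hrb hsf).2 hdd hsc'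
  exact (uvBounds_iff_densOfRecord₁₃_coPH F N θ w P h hC).1 huv k hk U

end AtParams



/-! ## §2. N11 ∧ N13 at Stage 13 under `Provisos₁₃CoPH`, BY NAME — N11 = seat dag-n11-a's construction-generic `b14_main_at_construction_rhoOfRecord9_along`, start slot fed by `sLaw₁₃CoPH_zero` -/

section Junction

variable (θ : Stage13HParams F N) (h : θ.Provisos₁₃CoPH F N) (w : WorldP) (P : B12.RunParams)

/-- **N11 ∧ N13 AT A STAGE-13 WORLD, BY NAME** (seat dag-n11-a's `B14NodeKnitRecord9.b14_main_at_construction_rhoOfRecord9_along` + `b16_main_at_record₁₃CoPH`): at `w.C =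
(datumOfRecord₁₃CoPH F N θ h).C`, `w.up P = upOfRecord₅C F N (θ.toStage5₁₃CoPH F N) P`, from THREE displayed slots — (S1ᵀ) `hT`: THE THEOREM OF [Balaban1988Convergent] p. 245 at
the Stage-13 objects of record — given N11's antecedents, a repaired-§2-format `ρ_k` of record has its T-image `𝐓ρ_k` of record in the corresponding space (`SLaw₁₃CoPH … k →
TLaw₁₃CoPH … k`), `k < K`; (R₁₃) `hR13`: [Balaban1989LargeFieldII] Thm 1 for 𝐑 at the objects of record (`TLaw₁₃CoPH … k → SLaw₁₃CoPH … (k+1)`); (UV₁₃) `hUV13`: (0.1) pointwise on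
`densOfRecord₁₃ θ` for `SLaw₁₃CoPH`-levels below `γ₁ ≥ w.γ`.  The START slot (S0) of n11-a's generic theorem is FED by node00-def-T's THEOREM `sLaw₁₃CoPH_zero`, and N11's (𝐑)
antecedent is read through `rOperation_iff_laws₁₃CoPH` (the binding equation), so neither is a hypothesis here. [cite: Balaban1988Convergent, Thm 1 p.262, Theorem p.245, p.244; Balaban1989LargeFieldII, Thm 1 p.355, (0.1) pp.355–356, p.387, p.391] -/
theorem nodes_N11_N13_at_record₁₃CoPH (hC : w.C = (datumOfRecord₁₃CoPH F N θ h).C) (hup : w.up P = upOfRecord₅C F N (θ.toStage5₁₃CoPH F N) P)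
    (hT : (leavesP w P).b7 → (leavesP w P).b8 → (leavesP w P).b9 → (leavesP w P).b10 → (leavesP w P).b11 →
      (leavesP w P).smallCouplings → (leavesP w P).smallFieldInductive → (leavesP w P).flowControl →
        ∀ k, k < P.K → SLaw₁₃CoPH F N θ P k → TLaw₁₃CoPH F N θ P k)
    (hR13 : ∀ k, k < P.K → TLaw₁₃CoPH F N θ P k → SLaw₁₃CoPH F N θ P (k + 1)) {γ₁ : ℝ} (hγ : w.γ ≤ γ₁)
    (hUV13 : (genFlow (betaOfRecord₁₃ F N θ.toStage13Params) P.g0).InInterval γ₁ P.K → ∀ k, k ≤ P.K → SLaw₁₃CoPH F N θ P k →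
      ∀ U : GaugeField (F.P P.K) k (SU N),
        chiβOfRecord₁₃ F N θ.toStage13Params P.K (gOfRecord₁₃ F N θ.toStage13Params P) k U *
              Real.exp (-(1 / (gOfRecord₁₃ F N θ.toStage13Params P k) ^ 2 * wilsonBGOfRecord F N θ.εbg P k U)
                - w.em (gOfRecord₁₃ F N θ.toStage13Params P k) * (Fintype.card (Site (F.P P.K) k) : ℝ)) ≤ densOfRecord₁₃ F N θ.toStage13Params P k U ∧
        densOfRecord₁₃ F N θ.toStage13Params P k U ≤ Real.exp (w.ep (gOfRecord₁₃ F N θ.toStage13Params P k) * (Fintype.card (Site (F.P P.K) k) : ℝ))) :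
    Dag.B14_main (leavesP w P) ∧ Dag.B16_main (leavesP w P) :=
  ⟨b14_main_at_construction_rhoOfRecord9_along F N (coreOfRecord₁₃CoPH F N θ) w P θ.ν θ.τ9 (EOfRecord₁₃ F N θ.toStage13Params) (wOfRecord₉ F N θ.toStage9Params) θ.ppSel
      (gOfRecord₁₃ F N θ.toStage13Params) (fun p k _ => SLaw₁₃CoPH F N θ p k) (fun p k _ => TLaw₁₃CoPH F N θ p k) (hC.trans (datumOfRecord₁₃CoPH_C F N θ h))
      (fun _ _ => Iff.rfl) (fun _ => sLaw₁₃CoPH_zero F N θ P) hT (fun hrop => (rOperation_iff_laws₁₃CoPH F N θ w P hup).1 hrop),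
    b16_main_at_record₁₃CoPH F N θ w P h hC hup hR13 hγ hUV13⟩

/-- **The run's (B) `Dag.UVStability4D (leavesP w P)` AT A STAGE-13 WORLD** («interval ⇒ §2 description ∧ (0.1)»): the three slots of `nodes_N11_N13_at_record₁₃CoPH`, GIVEN — as
hypotheses — N11's in-edge leaves `b7 … b11`, N13's `b5, b6, b13, rBasicStep`, the small-field leaf and the located flow step.  Pure composition.
[cite: Balaban1989LargeFieldII, Thm 1 + (0.1) p.355; Balaban1988Convergent, Thm 1 p.262] -/
theorem uvStability4D_at_record₁₃CoPH (hC : w.C = (datumOfRecord₁₃CoPH F N θ h).C) (hup : w.up P = upOfRecord₅C F N (θ.toStage5₁₃CoPH F N) P)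
    (hT : (leavesP w P).b7 → (leavesP w P).b8 → (leavesP w P).b9 → (leavesP w P).b10 → (leavesP w P).b11 →
      (leavesP w P).smallCouplings → (leavesP w P).smallFieldInductive → (leavesP w P).flowControl →
        ∀ k, k < P.K → SLaw₁₃CoPH F N θ P k → TLaw₁₃CoPH F N θ P k)
    (hR13 : ∀ k, k < P.K → TLaw₁₃CoPH F N θ P k → SLaw₁₃CoPH F N θ P (k + 1)) {γ₁ : ℝ} (hγ : w.γ ≤ γ₁)
    (hUV13 : (genFlow (betaOfRecord₁₃ F N θ.toStage13Params) P.g0).InInterval γ₁ P.K → ∀ k, k ≤ P.K → SLaw₁₃CoPH F N θ P k →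
      ∀ U : GaugeField (F.P P.K) k (SU N),
        chiβOfRecord₁₃ F N θ.toStage13Params P.K (gOfRecord₁₃ F N θ.toStage13Params P) k U *
              Real.exp (-(1 / (gOfRecord₁₃ F N θ.toStage13Params P k) ^ 2 * wilsonBGOfRecord F N θ.εbg P k U)
                - w.em (gOfRecord₁₃ F N θ.toStage13Params P k) * (Fintype.card (Site (F.P P.K) k) : ℝ)) ≤ densOfRecord₁₃ F N θ.toStage13Params P k U ∧
        densOfRecord₁₃ F N θ.toStage13Params P k U ≤ Real.exp (w.ep (gOfRecord₁₃ F N θ.toStage13Params P k) * (Fintype.card (Site (F.P P.K) k) : ℝ)))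
    (h5 : (leavesP w P).b5) (h6 : (leavesP w P).b6) (h7 : (leavesP w P).b7) (h8 : (leavesP w P).b8) (h9 : (leavesP w P).b9)
    (h10 : (leavesP w P).b10) (h11 : (leavesP w P).b11) (h13 : (leavesP w P).b13) (hrb : (leavesP w P).rBasicStep)
    (hsf : (leavesP w P).smallCouplings → (leavesP w P).smallFieldInductive)
    (hfc : (leavesP w P).smallCouplings → (leavesP w P).flowControl) :
    Dag.UVStability4D (leavesP w P) := by
  obtain ⟨h14, h16⟩ := nodes_N11_N13_at_record₁₃CoPH F N θ h w P hC hup hT hR13 hγ hUV13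
  obtain ⟨hrop, huv⟩ := h16 h5 h6 h7 h9 h10 h11 h13 hrb hsf
  have hdd : (leavesP w P).smallCouplings → (leavesP w P).densitiesDescribed := h14 h7 h8 h9 h10 h11 hsf hfc hrop
  exact fun hsc => ⟨hdd hsc, huv hdd hsc⟩

end Junction

/-! ## §3. N13 at Stage 13 under `Provisos₁₃CoPH` from the Cor.-3 chain's DOMINATED constants (`0 ≤ χ` by K0e's `chiFix29OfRecord_mem_Icc`) -/

section Dominated

variable (θ : Stage13HParams F N) (w : WorldP) (P : B12.RunParams) (h : θ.Provisos₁₃CoPH F N)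

/-- **N13 AT A STAGE-13 WORLD from (R₁₃) and DOMINATED per-step (0.1) constants** — the currency the cell's Cor.-3 chain delivers at the construction of record
(`B16Cor3CurlyGas.uvIneq_of_repr172_torus_of_ineq249_of_gas` ∕ `B16Cor3ActionBounds` at `D := (datumOfRecord₁₃CoPH F N θ h).C P`: a `Repr172` representation of `ρ_k` of record ⇒
`B16.UVIneq D k U E₋ E₊` pointwise): below the threshold every §2-format level admits `E₋ ≤ w.em(g_k)`, `E₊ ≤ w.ep(g_k)` with `B16.UVIneq ((datumOfRecord₁₃CoPH F N θ h).C P) k U E₋ E₊`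
for every `U` (`hUVd`); the sign convention `0 ≤ χ_k` is a THEOREM of record (K0e's `Node00.chiFix29OfRecord_mem_Icc`: `0 ≤ χ^{(2.9)} ≤ 1`), not a hypothesis.  Module 13's
`b16_main_at_repTowerOfRecord_dominated` (v1.1). [cite: Balaban1989LargeFieldII, Thm 1 p.355, (0.1) pp.355–356 («E₋, E₊ independent of k, T_η, U_k»), p.387; Balaban1988Convergent, (2.17) p.257] -/
theorem b16_main_at_record₁₃CoPH_dominated (hC : w.C = (datumOfRecord₁₃CoPH F N θ h).C) (hup : w.up P = upOfRecord₅C F N (θ.toStage5₁₃CoPH F N) P)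
    (hR13 : ∀ k, k < P.K → TLaw₁₃CoPH F N θ P k → SLaw₁₃CoPH F N θ P (k + 1)) {γ₁ : ℝ} (hγ : w.γ ≤ γ₁)
    (hUVd : (genFlow (betaOfRecord₁₃ F N θ.toStage13Params) P.g0).InInterval γ₁ P.K → ∀ k, k ≤ P.K → SLaw₁₃CoPH F N θ P k →
      ∃ Em Ep : ℝ, Em ≤ w.em (gOfRecord₁₃ F N θ.toStage13Params P k) ∧ Ep ≤ w.ep (gOfRecord₁₃ F N θ.toStage13Params P k) ∧
        ∀ U : GaugeField (F.P P.K) k (SU N), B16.UVIneq ((datumOfRecord₁₃CoPH F N θ h).C P) k U Em Ep) :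
    Dag.B16_main (leavesP w P) :=
  B16NodeKnitRepTowerOfRecord.b16_main_at_repTowerOfRecord_dominated F N (coreOfRecord₁₃CoPH F N θ) w P θ.ν θ.τ9 (EOfRecord₁₃ F N θ.toStage13Params)
    (wOfRecord₉ F N θ.toStage9Params) θ.ppSel (gOfRecord₁₃ F N θ.toStage13Params) (fun k _ => SLaw₁₃CoPH F N θ P k) (fun k _ => TLaw₁₃CoPH F N θ P k)
    (hC.trans (datumOfRecord₁₃CoPH_C F N θ h)) (fun _ _ hs => hs) (rOperation_iff_laws₁₃CoPH F N θ w P hup).2 (fun k hk _ hT => hR13 k hk hT) hγ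
    (fun k _ U => (chiFix29OfRecord_mem_Icc θ.ν θ.ε₂₉ P.K k U).1) hUVd

end Dominated

/-! ## §4. The Cor.-3 chain's END theorem AT THE OBJECTS OF RECORD (Stage 13, core-keyed datum `datumOfRecord₁₃CoPH`) -/

section ChainAtRecord

variable (θ : Stage13HParams F N) (h : θ.Provisos₁₃CoPH F N) (P : B12.RunParams) (k : ℕ)

/-- **(0.1) ∕ (2.50) AT THE CONSTRUCTION OF RECORD, unfolded** (`rfl` through `datumOfRecord₁₃CoPH_C` and `RGMachineCore.construction`): at `D := (datumOfRecord₁₃CoPH F N θ h).C P`,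
`B16.UVIneq D k V Em Ep` IS «`χ_k(V)·exp[−(1∕g_k²)A^η_k(V) − Em·|T₁^{(k)}|] ≤ ρ_k(V)` ∧ `ρ_k(V) ≤ exp(Ep·|T₁^{(k)}|)`» with `χ_k = chiβOfRecord₁₃ F N θ.toStage13Params P.K (gOfRecord₁₃ F N θ.toStage13Params P) k` (the (2.9) species),
`A^η_k = wilsonBGOfRecord F N θ.εbg P k`, `g_k = gOfRecord₁₃ F N θ.toStage13Params P k`, `ρ_k = densOfRecord₁₃ F N θ.toStage13Params P k` (EXPLICIT, `= eval rep_k`), `|T₁^{(k)}| = |Site (F.P P.K) k|`.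
[cite: Balaban1989LargeFieldII, (0.1) pp.355–356; Balaban1988Convergent, (2.17)–(2.18) p.257, (2.50) p.264 (bookkeeping)] -/
theorem uvIneq_at_record₁₃CoPH_iff (V : GaugeField (F.P P.K) k (SU N)) (Em Ep : ℝ) :
    B16.UVIneq ((datumOfRecord₁₃CoPH F N θ h).C P) k V Em Ep ↔
      chiβOfRecord₁₃ F N θ.toStage13Params P.K (gOfRecord₁₃ F N θ.toStage13Params P) k V *
            Real.exp (-(1 / (gOfRecord₁₃ F N θ.toStage13Params P k) ^ 2 * wilsonBGOfRecord F N θ.εbg P k V) - Em * (Fintype.card (Site (F.P P.K) k) : ℝ)) ≤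
          densOfRecord₁₃ F N θ.toStage13Params P k V ∧
        densOfRecord₁₃ F N θ.toStage13Params P k V ≤ Real.exp (Ep * (Fintype.card (Site (F.P P.K) k) : ℝ)) :=
  uvIneq_at_construction_iff F N (coreOfRecord₁₃CoPH F N θ) (densOfRecord₁₃ F N θ.toStage13Params) P k V Em Ep

/-- **THE COR.-3 CHAIN'S END THEOREM AT THE OBJECTS OF RECORD** — the junction of `B16Cor3CurlyGas.uvIneq_of_repr172_torus_of_ineq249_of_gas` to `densOfRecord₁₃ θ` at the Stage-13 datum: one run `P`, one
level `k`, at `D := (datumOfRecord₁₃CoPH F N θ h).C P`.  BINDERS = the chain's, READ AT THE RECORD: a (1.72) representation `R` of `ρ_k` OF RECORD on the torus cube catalogue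
(`hH : R.Holds (densOfRecord₁₃ F N θ.toStage13Params P k)` — [Balaban1989LargeFieldII] Thm 1's own output «𝐑ρ_k can be written in the form …», p. 390), its χ-dictionary against the (2.9) species `chiβOfRecord₁₃`
(`hχ01`, `h0χ`), the site count `|T₁^{(k)}| = (M₁·Nc)⁴` (`hnum`), the factor leaves (1.79)∕(1.89) per component (`hZ`, `hY`), the (1.90) gas of every admissible term at the
configurations `cfg : GaugeField (F.P P.K) k (SU N) → (Var → Sv)` (`hrefl … hjunction`, verbatim), the cube count (`hQ`), and (2.49) [III] for `R.A'` against
`(1∕g_k²)·A^η_k` of record with the volume majorant and the log-term bounds (`hCA`, `hΓ`, `h249`, `hlog`, `hlog'` — [Balaban1988Convergent] Thm 2's output: the N11 → N13 Cor.-3 edge AT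
THE RECORD).  The chain's sign binder `hA0 : 0 ≤ A^η_k(V)` is DISCHARGED: `Node00.wilsonBGOfRecord_nonneg` (a theorem of record).  Conclusion: (0.1) at every configuration with
`E₋ = CA·c_Γ + c_L + πc·b`, `E₊ = CA·c_Γ + c_L′ + πc·b + M₁⁻⁴·K₀(64,8)·Σ_i e^{−c_i}`, `b = c₁e^{τc_v}K₀`.  CONDITIONAL on every input; nothing of Bałaban's asserted; count-neutral.
[cite: Balaban1989LargeFieldII, (0.1) p.356, (1.72) p.379, p.387 after (1.89), (1.98) p.390; Balaban1988Convergent, (2.49)–(2.50) p.264] -/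
theorem uvIneq_at_record₁₃CoPH_of_gas (Nc : ℕ) [NeZero Nc] (R : Repr172 (GaugeField (F.P P.K) k (SU N)) (tsys 4 Nc).Dom)
    {M₁ : ℝ} (hM : M₁ ≠ 0) (hnum : (Fintype.card (Site (F.P P.K) k) : ℝ) = (M₁ * Nc) ^ 4)
    {κ₁ : ℝ} (hκ : B12TreeDecay.kappa₀ (4 * 2 ^ 4) (2 * 4) ≤ κ₁) (c : Fin 2 → ℝ)
    (hH : R.Holds (densOfRecord₁₃ F N θ.toStage13Params P k))
    (hχ01 : ∀ a V, 0 ≤ R.χ a V ∧ R.χ a V ≤ 1)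
    (h0χ : ∀ V, R.χ R.allSmall V = chiβOfRecord₁₃ F N θ.toStage13Params P.K (gOfRecord₁₃ F N θ.toStage13Params P) k V)
    (hZ : ∀ a V, (R.TZ a).T 1 V ≤ ∏ X ∈ R.Zc a, Real.exp (-(c 0) - κ₁ * (tsys 4 Nc).dj X))
    (hY : ∀ a V, (R.TYs a).T 1 V ≤ ∏ Y ∈ R.Ys a, Real.exp (-(c 1) - κ₁ * (tsys 4 Nc).dj Y))
    {LF DomY Cube Var Sv : Type*} [Fintype LF] [Fintype DomY] [Fintype Cube] [DecidableEq LF] [DecidableEq DomY]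
    [DecidableEq Cube] {adjC : Cube → Cube → Prop} [DecidableRel adjC]
    (hrefl : ∀ a, adjC a a) (hsymm : ∀ a b, adjC a b → adjC b a)
    {locX : LF → Finset Cube} {locY : DomY → Finset Cube} {site : Var → Cube} (Yfix : R.Adm → Finset Cube)
    (houtX : ∀ a j, (locX j \ Yfix a).Nonempty) (houtY : ∀ a Y, (locY Y \ Yfix a).Nonempty)
    (Op : R.Adm → Finset LF → ((Var → Sv) → ℂ) →+ ((Var → Sv) → ℂ))
    (hOps : ∀ a, LocalOps adjC locX (Yfix a) site (Op a))
    (hOpReal : ∀ a (S : Finset LF) (f : (Var → Sv) → ℂ), (∀ ψ, (f ψ).im = 0) → ∀ φ, (Op a S f φ).im = 0)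
    (Vt : R.Adm → DomY → (Var → Sv) → ℂ) (hV : ∀ a Y, DepOn (Yfix a) site (Vt a Y) (locY Y))
    (hVreal : ∀ a Y ψ, (Vt a Y ψ).im = 0) (cfg : GaugeField (F.P P.K) k (SU N) → (Var → Sv))
    {nbr : Cube → Finset Cube} (hnbr : ∀ a b, adjC a b → a ∈ nbr b) {νn : ℝ} (hν : ∀ b, ((nbr b).card : ℝ) ≤ νn)
    {d : R.Adm → Finset Cube → ℝ} {c₁ Rr κ₀ K₀ cv τ : ℝ} (hd : ∀ a X, 0 ≤ d a X) (hc₁ : 0 ≤ c₁) (hK₀ : 0 ≤ K₀)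
    (hτ : 0 ≤ τ)
    (h197 : ∀ a V X, ‖F191 adjC locX locY (Yfix a) (mayerTerm (Op a) (Vt a) (cfg V)) X‖ ≤ c₁ * Real.exp (-(Rr * d a X)))
    (h126 : ∀ a, Ineq126 (polys190 adjC locX locY (Yfix a)) (fun X => X \ Yfix a) (d a) κ₀ K₀)
    (hvol : ∀ a, VolBound (polys190 adjC locX locY (Yfix a)) (fun X => X \ Yfix a) (d a) cv)
    (hrate : κ₀ + τ * cv ≤ Rr) (hsmall : c₁ * Real.exp (τ * cv) * K₀ * νn ≤ τ)
    (hjunction : ∀ a V, R.curly a V = (bracket (Op a) (Vt a) (cfg V)).re)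
    {πc : ℝ} (hQ : (Fintype.card Cube : ℝ) ≤ πc * (Fintype.card (Site (F.P P.K) k) : ℝ))
    (logT : GaugeField (F.P P.K) k (SU N) → ℝ) {CA cΓ cL cL' : ℝ} {Γ : ℕ → ℝ} (hCA : 0 ≤ CA)
    (hΓ : ∑ n ∈ Finset.Icc 1 k, Γ n ≤ cΓ * (Fintype.card (Site (F.P P.K) k) : ℝ))
    (h249 : ∀ V, Ineq249 (R.A' V) (1 / (gOfRecord₁₃ F N θ.toStage13Params P k) ^ 2 * wilsonBGOfRecord F N θ.εbg P k V) (logT V) CA Γ k)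
    (hlog : ∀ V, -(cL * (Fintype.card (Site (F.P P.K) k) : ℝ)) ≤ logT V)
    (hlog' : ∀ V, logT V ≤ cL' * (Fintype.card (Site (F.P P.K) k) : ℝ)) :
    ∀ V : GaugeField (F.P P.K) k (SU N),
      B16.UVIneq ((datumOfRecord₁₃CoPH F N θ h).C P) k V (CA * cΓ + cL + πc * (c₁ * Real.exp (τ * cv) * K₀))
        (CA * cΓ + cL' + πc * (c₁ * Real.exp (τ * cv) * K₀) +
          M₁⁻¹ ^ 4 * B12TreeDecay.K₀ (4 * 2 ^ 4) (2 * 4) * ∑ i, Real.exp (-(c i))) :=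
  uvIneq_at_construction_of_gas F N (coreOfRecord₁₃CoPH F N θ) (densOfRecord₁₃ F N θ.toStage13Params) P k Nc R hM hnum hκ c hH hχ01 h0χ hZ hY
    hrefl hsymm Yfix houtX houtY Op hOps hOpReal Vt hV hVreal cfg hnbr hν hd hc₁ hK₀ hτ h197 h126 hvol hrate hsmall hjunction hQ
    logT hCA hΓ h249 hlog hlog' (fun V => wilsonBGOfRecord_nonneg F N θ.εbg P k V)

end ChainAtRecord

/-! ## §5. N13 at a Stage-13 world (core-keyed datum) from (R₁₃) + the chain's output IN ITS OWN LETTERS, dominated by the world's dependence functions -/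

section Knit

variable (θ : Stage13HParams F N) (w : WorldP) (P : B12.RunParams) (h : θ.Provisos₁₃CoPH F N)

/-- **N13 AT A STAGE-13 WORLD FROM (R₁₃) AND THE COR.-3 CHAIN'S OUTPUT IN ITS OWN LETTERS** ([Balaban1989LargeFieldII] Thm 1 p. 355 + (0.1), Cor. 3 pp. 387 ∕ 391, AT NODE 00's
Stage-13 objects): for `w.C = (datumOfRecord₁₃CoPH F N θ h).C`, `w.up P = upOfRecord₅C F N (θ.toStage5₁₃CoPH F N) P`, from — (R₁₃) `hR13` (law transport by 𝐑 along the tower of record; IS the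
leaf, §1); level-indexed constant families in the chain's letters `CA, cΓ, cL, cL′, πc, c₁, τ, cv, K₀, M₁ : ℕ → ℝ`, `c : ℕ → Fin 2 → ℝ` (the (2.49) constant and log-term
slopes, the cube-count ratio, the (1.97)∕Kotecký–Preiss constants, the cube side, the (1.79)∕(1.89) exponents); `huv`: below the threshold `γ₁ ≥ w.γ`, every §2-format level `k ≤ K`
satisfies (0.1) at every configuration with `E₋(k) = CA·cΓ + cL + πc·(c₁e^{τcv}K₀)`, `E₊(k) = E₋-shape with cL′ + M₁⁻⁴·K₀(64,8)·Σ_i e^{−c_i}` — EXACTLY the conclusion of §1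
`uvIneq_at_record₁₃CoPH_of_gas` (§4) at level `k` (so `huv` is supplied level by level from a (1.72) representation of `ρ_k` of record + the chain's leaves); `hdom`: DOMINATION
`E₋(k) ≤ w.em (g_k)`, `E₊(k) ≤ w.ep (g_k)` by the world's dependence functions of the coupling (p. 356 «E₋, E₊ independent of k, T_η, U_k» in the tree's reading: functions of
`g_k` alone).  = §3 `b16_main_at_record₁₃CoPH_dominated` with `Em := E₋(k)`, `Ep := E₊(k)`.  HYPOTHESES displayed; count-neutral; nothing of Bałaban's asserted.
[cite: Balaban1989LargeFieldII, Thm 1 p.355, (0.1) pp.355–356, p.387, p.391; Balaban1988Convergent, p.244, (2.49)–(2.50) p.264] -/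
theorem b16_main_at_record₁₃CoPH_of_chainLetters (hC : w.C = (datumOfRecord₁₃CoPH F N θ h).C) (hup : w.up P = upOfRecord₅C F N (θ.toStage5₁₃CoPH F N) P)
    (hR13 : ∀ k, k < P.K → TLaw₁₃CoPH F N θ P k → SLaw₁₃CoPH F N θ P (k + 1)) {γ₁ : ℝ} (hγ : w.γ ≤ γ₁)
    (CA cΓ cL cL' πc c₁ τ cv K₀ M₁ : ℕ → ℝ) (c : ℕ → Fin 2 → ℝ)
    (huv : (genFlow (betaOfRecord₁₃ F N θ.toStage13Params) P.g0).InInterval γ₁ P.K → ∀ k, k ≤ P.K → SLaw₁₃CoPH F N θ P k →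
      ∀ V : GaugeField (F.P P.K) k (SU N),
        B16.UVIneq ((datumOfRecord₁₃CoPH F N θ h).C P) k V (CA k * cΓ k + cL k + πc k * (c₁ k * Real.exp (τ k * cv k) * K₀ k))
          (CA k * cΓ k + cL' k + πc k * (c₁ k * Real.exp (τ k * cv k) * K₀ k) +
            (M₁ k)⁻¹ ^ 4 * B12TreeDecay.K₀ (4 * 2 ^ 4) (2 * 4) * ∑ i, Real.exp (-(c k i))))
    (hdom : ∀ k, k ≤ P.K →
      CA k * cΓ k + cL k + πc k * (c₁ k * Real.exp (τ k * cv k) * K₀ k) ≤ w.em (gOfRecord₁₃ F N θ.toStage13Params P k) ∧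
      CA k * cΓ k + cL' k + πc k * (c₁ k * Real.exp (τ k * cv k) * K₀ k) +
          (M₁ k)⁻¹ ^ 4 * B12TreeDecay.K₀ (4 * 2 ^ 4) (2 * 4) * ∑ i, Real.exp (-(c k i)) ≤ w.ep (gOfRecord₁₃ F N θ.toStage13Params P k)) :
    Dag.B16_main (leavesP w P) :=
  b16_main_at_record₁₃CoPH_dominated F N θ w P h hC hup hR13 hγ fun hsc k hk hS =>
    ⟨_, _, (hdom k hk).1, (hdom k hk).2, huv hsc k hk hS⟩

end Knit


/-! ## §6. N13, and N11 ∧ N13, at NODE 00's Co record `IsRecordOfRecord₁₃CCoPH` — the two RECORD-KEYED forms of module 36 over §1–§2 -/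

section AtRecord

variable {F N} {D : FiniteEpsData F (SU N)} {w : WorldP}

/-- **N13 AT NODE 00's STAGE-13 RECORD `IsRecordOfRecord₁₃CCoPH`** — from the per-parameter products at the objects of record: for the record's admissible `θ` with
provisos `h` (`D = datumOfRecord₁₃CoPH F N θ h`, runs bound over `θ.toStage5₁₃CoPH F N`), (R₁₃) law transport by 𝐑 along the tower at every run and (UV₁₃) (0.1) pointwise on
`densOfRecord₁₃ θ` for repaired-§2-format levels below `w.γ`.  The KEYED form N24's Stage-13 knit consumes.
[cite: Balaban1989LargeFieldII, Thm 1 p.355, (0.1) pp.355–356, p.387, p.391; Balaban1988Convergent, p.244, Cor. 3 p.264] -/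
theorem b16_main_of_isRecordOfRecord₁₃CCoPH (hrec : IsRecordOfRecord₁₃CCoPH F N D w)
    (slots : ∀ (θ : Stage13HParams F N) (h : θ.Provisos₁₃CoPH F N), θ.Admissible F N → D = datumOfRecord₁₃CoPH F N θ h →
      (∀ P, w.up P = upOfRecord₅C F N (θ.toStage5₁₃CoPH F N) P) → ∀ P : B12.RunParams,
        (∀ k, k < P.K → TLaw₁₃CoPH F N θ P k → SLaw₁₃CoPH F N θ P (k + 1)) ∧
        ((genFlow (betaOfRecord₁₃ F N θ.toStage13Params) P.g0).InInterval w.γ P.K → ∀ k, k ≤ P.K → SLaw₁₃CoPH F N θ P k →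
          ∀ U : GaugeField (F.P P.K) k (SU N),
            chiβOfRecord₁₃ F N θ.toStage13Params P.K (gOfRecord₁₃ F N θ.toStage13Params P) k U *
                  Real.exp (-(1 / (gOfRecord₁₃ F N θ.toStage13Params P k) ^ 2 * wilsonBGOfRecord F N θ.εbg P k U)
                    - w.em (gOfRecord₁₃ F N θ.toStage13Params P k) * (Fintype.card (Site (F.P P.K) k) : ℝ)) ≤ densOfRecord₁₃ F N θ.toStage13Params P k U ∧
            densOfRecord₁₃ F N θ.toStage13Params P k U ≤ Real.exp (w.ep (gOfRecord₁₃ F N θ.toStage13Params P k) * (Fintype.card (Site (F.P P.K) k) : ℝ)))) :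
    ∀ P : B12.RunParams, Dag.B16_main (leavesP w P) := by
  intro P
  obtain ⟨θ, h, hθ, hD, hC, -, -, hup⟩ := hrec
  obtain ⟨hR13, hUV13⟩ := slots θ h hθ hD hup P
  exact B16NodeKnitRecord13CoPH.b16_main_at_record₁₃CoPH F N θ w P h (by rw [hC, hD]) (hup P) hR13 le_rfl hUV13

end AtRecord

section Junction

variable {F N} {D : FiniteEpsData F (SU N)}

/-- **N11 ∧ N13 at every run of a Stage-13 record** from the per-parameter slot TRIPLE (S1ᵀ), (R₁₃), (UV₁₃) at the objects of record (no start slot) — the K1-class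
«Nodes» conjuncts for N11 and N13 at ₁₃C. [cite: Balaban1988Convergent, Thm 1 p.262, Theorem p.245; Balaban1989LargeFieldII, Thm 1 p.355, (0.1) pp.355–356, p.387, p.391] -/
theorem nodes_N11_N13_of_isRecordOfRecord₁₃CCoPH {w : WorldP} (hrec : IsRecordOfRecord₁₃CCoPH F N D w)
    (slots : ∀ (θ : Stage13HParams F N) (h : θ.Provisos₁₃CoPH F N), θ.Admissible F N → D = datumOfRecord₁₃CoPH F N θ h →
      (∀ P, w.up P = upOfRecord₅C F N (θ.toStage5₁₃CoPH F N) P) → ∀ P : B12.RunParams,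
        ((leavesP w P).b7 → (leavesP w P).b8 → (leavesP w P).b9 → (leavesP w P).b10 → (leavesP w P).b11 →
          (leavesP w P).smallCouplings → (leavesP w P).smallFieldInductive → (leavesP w P).flowControl →
            ∀ k, k < P.K → SLaw₁₃CoPH F N θ P k → TLaw₁₃CoPH F N θ P k) ∧
        (∀ k, k < P.K → TLaw₁₃CoPH F N θ P k → SLaw₁₃CoPH F N θ P (k + 1)) ∧
        ((genFlow (betaOfRecord₁₃ F N θ.toStage13Params) P.g0).InInterval w.γ P.K → ∀ k, k ≤ P.K → SLaw₁₃CoPH F N θ P k →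
          ∀ U : GaugeField (F.P P.K) k (SU N),
            chiβOfRecord₁₃ F N θ.toStage13Params P.K (gOfRecord₁₃ F N θ.toStage13Params P) k U *
                  Real.exp (-(1 / (gOfRecord₁₃ F N θ.toStage13Params P k) ^ 2 * wilsonBGOfRecord F N θ.εbg P k U)
                    - w.em (gOfRecord₁₃ F N θ.toStage13Params P k) * (Fintype.card (Site (F.P P.K) k) : ℝ)) ≤ densOfRecord₁₃ F N θ.toStage13Params P k U ∧
            densOfRecord₁₃ F N θ.toStage13Params P k U ≤ Real.exp (w.ep (gOfRecord₁₃ F N θ.toStage13Params P k) * (Fintype.card (Site (F.P P.K) k) : ℝ)))) :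
    ∀ P : B12.RunParams, Dag.B14_main (leavesP w P) ∧ Dag.B16_main (leavesP w P) := by
  intro P
  obtain ⟨θ, h, hθ, hD, hC, -, -, hup⟩ := hrec
  obtain ⟨hT, hR13, hUV13⟩ := slots θ h hθ hD hup P
  exact B16NodeKnitRecord13CoPH.nodes_N11_N13_at_record₁₃CoPH F N θ h w P (by rw [hC, hD]) (hup P) hT hR13 le_rfl hUV13

end Junction

end Literature.MathematicalPhysics.QuantumFieldTheory.Balaban1983to89.B16NodeKnitRecord13CoPH

end
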